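import Summits.AtomisticToContinuum.BoseEinsteinCondensation.Theorems.KineticLatticeBEC.Negative.Toolkit

/-!
# Negative lemmas for crux `KineticLatticeBEC` (stmt-AtomisticToContinuum-9671), IV: particle–hole
symmetry of the right-hand side and the immateriality of the cap `½`

Supports (does not close) stmt-AtomisticToContinuum-9671. The global spin flip `U = ⨂σˣ` fixes the crux
observable and maps `H_pen(L,N)` to `H_pen(L,L³−N)` (`flip_conj_Hpen`), whence the exact identity
`rhs_particle_hole : rhs(L,N) = rhs(L,L³−N) + 2N − L³` (`N₀(N) = N₀(L³−N) + (2N−L³)/L³`) and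
`kineticLatticeBEC_iff_cap`: for every `0 < δ ≤ ½` the crux is equivalent to uniform BEC up to the cap
`N ≤ (1−δ)L³` (constant `cδ`). The RP-born threshold `½` carries no information.
-/

noncomputable section

namespace Summit.AtomisticToContinuum.BoseEinsteinCondensation.Theorems.KineticLatticeBEC.Negative

open scoped BigOperators ComplexOrder
open Literature.MathematicalPhysics.QuantumLattice Literature.Probability.LatticeModels Matrix Finset
open Summit.AtomisticToContinuum.BoseEinsteinCondensation.Theses.BECStronglyRayleigh
open Summit.AtomisticToContinuum.BoseEinsteinCondensation.Theorems.LatticeODLROOffHalfFilling.Negative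

/-! ### §4 PARTICLE–HOLE SYMMETRY: `rhs(L,N) = rhs(L,L³−N) + 2N − L³`, and the cap `½` is immaterial

The global spin flip `U = ⨂σˣ` (bosonic particle–hole map) fixes `O = (S¹)²+(S²)²` and maps
`H_pen(L,N)` to `H_pen(L,L³−N)`; covariance of the tracial ground state gives the exact identity
`rhs_particle_hole`. Consequences: the zero-mode occupations satisfy `N₀(N) = N₀(L³−N) + (2N−L³)/L³`,
so (i) uniform BEC up to ANY fixed-fraction cap `N ≤ (1−δ)L³`, `0 < δ ≤ ½`, is EQUIVALENT to the crux
(`kineticLatticeBEC_iff_cap`: the RP-born `½` carries no information), while (ii) every cap of the form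
`N ≤ L³ − K` with `K` FIXED is refuted in §2/§5 — the filling hypothesis is load-bearing exactly at
linear order in `L³`. -/

section ParticleHole

variable {Λ : Type*} [Fintype Λ] [DecidableEq Λ]

/-- The crux observable is particle–hole invariant: `U O Uᴴ = O`. [folklore] -/
theorem flip_conj_obsO : flipOp * obsO Λ * flipOpᴴ = obsO Λ := by
  rw [obsO_eq_sum_hop, Finset.mul_sum, Finset.sum_mul]
  refine Finset.sum_congr rfl fun x _ => ?_
  rw [Finset.mul_sum, Finset.sum_mul]
  exact Finset.sum_congr rfl fun y _ => flip_conj_hop x y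

variable (L : ℕ) [NeZero L]

/-- `U pen(L,N) Uᴴ = −pen(L,L³−N)` for `N ≤ L³`. [folklore] -/
theorem flip_conj_pen {N : ℕ} (hN : N ≤ L ^ 3) :
    flipOp * pen L N * flipOpᴴ = -pen L (L ^ 3 - N) := by
  rw [pen, pen, Matrix.mul_add, Matrix.add_mul, flip_conj_totalSpin_two, Matrix.mul_smul,
    Matrix.smul_mul, Matrix.mul_one, flipOp_mul_conjTranspose, Nat.cast_sub hN, Nat.cast_pow,
    neg_add, ← neg_smul]
  congr 1
  ring

/-- **`U H_pen(L,N) Uᴴ = H_pen(L,L³−N)`** (`L ≥ 3`, `N ≤ L³`). [folklore] -/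
theorem flip_conj_Hpen (hL : 3 ≤ L) {N : ℕ} (hN : N ≤ L ^ 3) :
    flipOp * Hpen L N * flipOpᴴ = Hpen L (L ^ 3 - N) := by
  have hsq : flipOp * (pen L N * pen L N) * flipOpᴴ =
      (flipOp * pen L N * flipOpᴴ) * (flipOp * pen L N * flipOpᴴ) := by
    rw [Matrix.mul_assoc (flipOp * pen L N) flipOpᴴ (flipOp * pen L N * flipOpᴴ),
      ← Matrix.mul_assoc flipOpᴴ (flipOp * pen L N) flipOpᴴ,
      ← Matrix.mul_assoc flipOpᴴ flipOp (pen L N), flipOp_conjTranspose_mul, Matrix.one_mul,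
      Matrix.mul_assoc, Matrix.mul_assoc, Matrix.mul_assoc]
  rw [Hpen_eq, Hpen_eq, Matrix.mul_add, Matrix.add_mul, xyTorus_eq_Hmu_zero, flip_conj_hmu L hL 0,
    neg_zero, Matrix.mul_smul, Matrix.smul_mul, pow_two, pow_two, hsq, flip_conj_pen L hN,
    neg_mul_neg]

/-- The tracial ground-state expectation of `O` is particle–hole symmetric. [folklore] -/
theorem gsf_obsO_particle_hole (hL : 3 ≤ L) {N : ℕ} (hN : N ≤ L ^ 3) :
    (Hpen L (L ^ 3 - N)).groundStateFunctional (obsO (TorusSite 3 L)) =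
      (Hpen L N).groundStateFunctional (obsO (TorusSite 3 L)) := by
  have h := groundStateFunctional_unitary_conj (A := Hpen L N) flipOp_mul_conjTranspose
    flipOp_conjTranspose_mul (obsO (TorusSite 3 L))
  rwa [flip_conj_Hpen L hL hN, flip_conj_obsO] at h

/-- **PARTICLE–HOLE IDENTITY** `rhs(L,N) = rhs(L,L³−N) + 2N − L³` (`L ≥ 3`, `N ≤ L³`); in terms of
zero-mode occupations `N₀(N) = N₀(L³−N) + (2N − L³)/L³`. [folklore] -/
theorem rhs_particle_hole (hL : 3 ≤ L) {N : ℕ} (hN : N ≤ L ^ 3) :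
    rhs L N = rhs L (L ^ 3 - N) + 2 * N - (L : ℝ) ^ 3 := by
  rw [rhs, rhs, gsf_obsO_particle_hole L hL hN, Nat.cast_sub hN, Nat.cast_pow]
  ring

end ParticleHole

/-- The crux with the half-filling cap replaced by a fixed-fraction cap `N ≤ (1 − δ)L³`. -/
def KineticLatticeBECCap (δ : ℝ) : Prop :=
  ∃ c : ℝ, 0 < c ∧ ∃ L₀ : ℕ, ∀ (L : ℕ) [NeZero L], L₀ ≤ L → Even L → ∀ N : ℕ, 1 ≤ N →
    (N : ℝ) ≤ (1 - δ) * (L : ℝ) ^ 3 → c * N * (L : ℝ) ^ 3 ≤ rhs L N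

/-- **The cap `½` is immaterial**: for every `0 < δ ≤ ½`, uniform BEC at all fillings `≤ 1 − δ` is
EQUIVALENT to the crux (fillings `≤ ½`), by the particle–hole identity (constant `c ↦ cδ`).
[folklore] -/
theorem kineticLatticeBEC_iff_cap {δ : ℝ} (hδ : 0 < δ) (hδ' : δ ≤ 1 / 2) :
    KineticLatticeBEC ↔ KineticLatticeBECCap δ := by
  rw [kineticLatticeBEC_iff]
  constructor
  · rintro ⟨c, hc, L₀, h⟩
    refine ⟨c * δ, mul_pos hc hδ, max L₀ 3, fun L _ hL hE N hN1 hNcap => ?_⟩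
    have hL₀ : L₀ ≤ L := le_trans (le_max_left _ _) hL
    have hL3 : 3 ≤ L := le_trans (le_max_right _ _) hL
    have hLpos : (0 : ℝ) < (L : ℝ) ^ 3 := by positivity
    have hNle : N ≤ L ^ 3 := by
      have : (N : ℝ) ≤ (L : ℝ) ^ 3 := by nlinarith
      exact_mod_cast this
    by_cases h2N : 2 * N ≤ L ^ 3
    · have key := h L hL₀ hE N hN1 h2N
      have : c * δ * N * (L : ℝ) ^ 3 ≤ c * N * (L : ℝ) ^ 3 := by
        have hN0 : (0 : ℝ) ≤ N := Nat.cast_nonneg _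
        have : c * δ ≤ c * 1 := by nlinarith
        nlinarith [mul_nonneg hN0 hLpos.le]
      linarith
    · push Not at h2N
      -- the mirror filling N' = L³ − N is at most half and at least δ L³ ≥ 1
      have hN'1 : 1 ≤ L ^ 3 - N := by
        have : (N : ℝ) < (L : ℝ) ^ 3 := by nlinarith
        have : N < L ^ 3 := by exact_mod_cast this
        omega
      have hN'2 : 2 * (L ^ 3 - N) ≤ L ^ 3 := by omega
      have key := h L hL₀ hE (L ^ 3 - N) hN'1 hN'2
      rw [rhs_particle_hole L hL3 hNle]
      have hcast : ((L ^ 3 - N : ℕ) : ℝ) = (L : ℝ) ^ 3 - N := by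
        rw [Nat.cast_sub hNle, Nat.cast_pow]
      rw [hcast] at key
      -- key : c (L³ − N) L³ ≤ rhs L (L³−N); and L³ − N ≥ δ L³, 2N − L³ ≥ 0
      have h2N' : (L : ℝ) ^ 3 ≤ 2 * N := by exact_mod_cast h2N.le
      have hmirror : δ * (L : ℝ) ^ 3 ≤ (L : ℝ) ^ 3 - N := by nlinarith
      have hNL : (N : ℝ) ≤ (L : ℝ) ^ 3 := by exact_mod_cast hNle
      have h1 : c * δ * N * (L : ℝ) ^ 3 ≤ c * (δ * (L : ℝ) ^ 3) * (L : ℝ) ^ 3 := by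
        have : c * δ * N ≤ c * δ * (L : ℝ) ^ 3 := by nlinarith [mul_pos hc hδ]
        nlinarith
      have h2 : c * (δ * (L : ℝ) ^ 3) * (L : ℝ) ^ 3 ≤ c * ((L : ℝ) ^ 3 - N) * (L : ℝ) ^ 3 := by
        nlinarith [mul_pos hc hLpos]
      linarith
  · rintro ⟨c, hc, L₀, h⟩
    refine ⟨c, hc, L₀, fun L _ hL hE N hN1 h2N => h L hL hE N hN1 ?_⟩
    have : (2 * N : ℝ) ≤ (L : ℝ) ^ 3 := by exact_mod_cast h2N
    nlinarith



end Summit.AtomisticToContinuum.BoseEinsteinCondensation.Theorems.KineticLatticeBEC.Negative
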